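import Mathlib
import HarnessLib
import Summits.NavierStokesRegularity.NavierStokesRegularity.Theorems.PoloidalWindowDoorPoloidalWindowRigiditySymmetryGerms

/-!
# K2 `PoloidalWindowRigidity` (stmt-NavierStokesRegularity-19708) — GERMS OF ENTIRE UNBOUNDED FLOWS ARE NOT GERMS OF THE CLASS

Cell ns-regularity-ideate, seat nsreg-p7 gen 8 (third worker under the K2 lead ns-poloidal-K2-p1; line lrc-jet v2,
stub `stub_lrcSpatial`).  The exact census of this generation (HOME memo KARIG §§3, 6, 9, 11) says that the formal
poloidal steady Navier–Stokes solution variety has no first-order exit from the known strata anywhere tested, and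
that the only non-symmetric explicit poloidal flows — refuter1's crossed suction layers and their deformations — are
ENTIRE fields of exponential growth.  For the crux this is enough by itself: a profile of the route's Type-I class has
real-analytic slices on all of `ℝ³` (tree `analyticOnNhd_slice`) bounded by `C/√(−s)`, so if ONE of its slices agrees
with an entire field on a nonempty open set, it IS that field (identity theorem) and the field inherits the bound.
Hence an exceptional stratum of LRC″ that consists of germs of entire, spatially UNBOUNDED solutions costs the line
nothing — the «classification modulo an explicit unbounded family» form of the local rigidity statement closes K2 as
well as the «symmetry» form does (KARIG §11).

* `slice_eq_of_eqOn_open` — a slice `v s` (`s < 0`) of a profile of the class that agrees with an entire real-analytic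
  field `w` on a nonempty open set agrees with `w` on `ℝ³`.
* `norm_le_of_slice_eqOn_open` — then `‖w y‖ ≤ C/√(−s)` for every `y`.
* `not_slice_eqOn_open_of_exceeds` — contrapositive: if `‖w y₀‖ > C/√(−s)` for some `y₀`, no slice-`s` germ of the
  profile is a germ of `w`.
* `not_slice_eqOn_open_of_not_bddAbove` — the same for an entire field whose norm is unbounded on `ℝ³` (every `s < 0`).

WHAT THIS IS NOT: not a claim about Navier–Stokes regularity, not the crux, not LRC″ — the analytic-continuation
bookkeeping that lets an explicit unbounded exceptional family be discharged (bears_on LADDER-NS N0, route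
PoloidalWindowDoor, crux K2; `--supports` the K2 item).
-/

noncomputable section

-- the summit and its single sub-problem share the name (CONVENTIONS §1), as in every Theorems file
set_option linter.dupNamespace false

namespace Summit.NavierStokesRegularity.NavierStokesRegularity.Theorems.PoloidalWindowDoorPoloidalWindowRigidityEntireGerm

open MeasureTheory Set Function Filter Topology Metric
open Literature.Analysis Literature.Analysis.FluidPDE
open Summit.NavierStokesRegularity.NavierStokesRegularity.Theorems.LocalSineTubeDoorProfileAlignedWindowRigidityAncient
open Summit.NavierStokesRegularity.NavierStokesRegularity.Theorems.PoloidalWindowDoorPoloidalWindowRigiditySymmetryGerms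

variable {C : ℝ} {v : ℝ → EuclideanSpace ℝ (Fin 3) → EuclideanSpace ℝ (Fin 3)}

/-- **A germ of the class is global.**  If the slice `v s` (`s < 0`) of a profile of the route's Type-I class
(Type-I time decay, continuous on the slab, unit-viscosity Oseen-mild) agrees with an entire real-analytic field `w` on
a nonempty open set, then `v s = w` on all of `ℝ³` (both are real-analytic on `ℝ³`; identity theorem). -/
theorem slice_eq_of_eqOn_open (hrate : HasTypeITimeDecay C v)
    (hcont : ContinuousOn (uncurry v) (Iio (0 : ℝ) ×ˢ univ))
    (hmild : ∀ s t : ℝ, s < t → t < 0 → ∀ x,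
      v t x = UnboundedOperators.heatExtension (v s) (t - s) x - oseenDuhamel 1 s v v t x)
    {s : ℝ} (hs : s < 0) {w : EuclideanSpace ℝ (Fin 3) → EuclideanSpace ℝ (Fin 3)}
    (hw : AnalyticOnNhd ℝ w univ) {U : Set (EuclideanSpace ℝ (Fin 3))} (hU : IsOpen U) (hne : U.Nonempty)
    (h : ∀ y ∈ U, v s y = w y) (y : EuclideanSpace ℝ (Fin 3)) : v s y = w y :=
  eq_of_eqOn_open (analyticOnNhd_slice hcont (bdd_of_hasTypeITimeDecay hrate) hmild hs) hw hU hne h y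

/-- **An entire field that carries a germ of the class obeys the Type-I bound everywhere.**  Under the hypotheses of
`slice_eq_of_eqOn_open`, `‖w y‖ ≤ C / √(−s)` for every `y ∈ ℝ³`. -/
theorem norm_le_of_slice_eqOn_open (hrate : HasTypeITimeDecay C v)
    (hcont : ContinuousOn (uncurry v) (Iio (0 : ℝ) ×ˢ univ))
    (hmild : ∀ s t : ℝ, s < t → t < 0 → ∀ x,
      v t x = UnboundedOperators.heatExtension (v s) (t - s) x - oseenDuhamel 1 s v v t x)
    {s : ℝ} (hs : s < 0) {w : EuclideanSpace ℝ (Fin 3) → EuclideanSpace ℝ (Fin 3)}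
    (hw : AnalyticOnNhd ℝ w univ) {U : Set (EuclideanSpace ℝ (Fin 3))} (hU : IsOpen U) (hne : U.Nonempty)
    (h : ∀ y ∈ U, v s y = w y) (y : EuclideanSpace ℝ (Fin 3)) : ‖w y‖ ≤ C / Real.sqrt (-s) := by
  rw [← slice_eq_of_eqOn_open hrate hcont hmild hs hw hU hne h y]
  exact hrate s hs y

/-- **An entire field that exceeds the Type-I bound somewhere is nowhere a germ of the class (at that time).**  If
`‖w y₀‖ > C / √(−s)` for some `y₀`, then the slice `v s` of a profile of the class agrees with `w` on NO nonempty open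
set.  (For refuter1's crossed suction layers and every other entire solution of exponential growth, `y₀` exists for
every `s < 0` and every `C`.) -/
theorem not_slice_eqOn_open_of_exceeds (hrate : HasTypeITimeDecay C v)
    (hcont : ContinuousOn (uncurry v) (Iio (0 : ℝ) ×ˢ univ))
    (hmild : ∀ s t : ℝ, s < t → t < 0 → ∀ x,
      v t x = UnboundedOperators.heatExtension (v s) (t - s) x - oseenDuhamel 1 s v v t x)
    {s : ℝ} (hs : s < 0) {w : EuclideanSpace ℝ (Fin 3) → EuclideanSpace ℝ (Fin 3)}
    (hw : AnalyticOnNhd ℝ w univ) {y₀ : EuclideanSpace ℝ (Fin 3)} (hy₀ : C / Real.sqrt (-s) < ‖w y₀‖)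
    {U : Set (EuclideanSpace ℝ (Fin 3))} (hU : IsOpen U) (hne : U.Nonempty) :
    ¬ (∀ y ∈ U, v s y = w y) := fun h =>
  (not_le.2 hy₀) (norm_le_of_slice_eqOn_open hrate hcont hmild hs hw hU hne h y₀)

/-- **Unbounded entire fields are nowhere germs of the class.**  If the norm of the entire field `w` is not bounded
above on `ℝ³`, then for every `s < 0` the slice `v s` of a profile of the class agrees with `w` on no nonempty open
set. -/
theorem not_slice_eqOn_open_of_not_bddAbove (hrate : HasTypeITimeDecay C v)
    (hcont : ContinuousOn (uncurry v) (Iio (0 : ℝ) ×ˢ univ))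
    (hmild : ∀ s t : ℝ, s < t → t < 0 → ∀ x,
      v t x = UnboundedOperators.heatExtension (v s) (t - s) x - oseenDuhamel 1 s v v t x)
    {s : ℝ} (hs : s < 0) {w : EuclideanSpace ℝ (Fin 3) → EuclideanSpace ℝ (Fin 3)}
    (hw : AnalyticOnNhd ℝ w univ) (hunb : ¬ BddAbove (Set.range fun y => ‖w y‖))
    {U : Set (EuclideanSpace ℝ (Fin 3))} (hU : IsOpen U) (hne : U.Nonempty) :
    ¬ (∀ y ∈ U, v s y = w y) := by
  intro h
  exact hunb ⟨C / Real.sqrt (-s), by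
    rintro _ ⟨y, rfl⟩
    exact norm_le_of_slice_eqOn_open hrate hcont hmild hs hw hU hne h y⟩

end Summit.NavierStokesRegularity.NavierStokesRegularity.Theorems.PoloidalWindowDoorPoloidalWindowRigidityEntireGerm
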